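import Summits.NavierStokesRegularity.NavierStokesRegularity.Theses.PalasekTowerBreakdown
import Summits.NavierStokesRegularity.FluidComputer.PalasekTowerHeredityAtOneWitness

/-!
# NavierStokesRegularity — route `PalasekTowerBreakdown`, item `HeredityFromTwo`: witness form

Supports `stmt-NavierStokesRegularity-19250` (`HeredityFromTwo` = heredity from level `2`, the
generic half of the split crux `EpisodeInduction`; it does NOT close it). Cell `ns-blowup`, seat
`ns-blowup-ecbridge-6` (D-0074 GROUP C «BRIDGE SUPPORT»). In the route's OWN vocabulary:

  `TaoForcedUniqueness → (HeredityFromTwo ↔ ∀ k ≥ 2, HeredityWitness k)`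

— modulo the route's support item `TaoForcedUniqueness` (W14), heredity from level `2` is EXACTLY
the typed heredity witness (`…PalasekTowerClayBridge.HeredityWitness k`: every pinned rigid quiet
wide design that earned a registered G-stage at level `k` has a level witness at `k` — its own
classical finite-energy flow from the Clay datum under the design force reaches `τ (k+1)` below
`(5/3) Y_{k+1}` on the window and shows the three level-`k+1` floors there) at every `k ≥ 2`, and
`TaoForcedUniqueness → (∀ k ≥ 2, HeredityWitness k) → HeredityFromTwo`. Kernel content:
`heredityFrom_iff_heredityWitness` (FluidComputer/PalasekTowerHeredityAtOneWitness.lean p419314).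
MODEL tower words are analogues of the witnesses, never instances; nothing is asserted.

WHAT THIS IS NOT: not NS — a conditional reformulation; no stage, flow or tower is constructed.
-/

-- `Summit.<Summit>.<Problem>` is the tree's mandated summit-side namespace (CONVENTIONS §2); for this
-- single-conjunct summit the two coincide, so the duplicate is deliberate.
set_option linter.dupNamespace false

namespace Summit.NavierStokesRegularity.NavierStokesRegularity.Theorems

open Summit.NavierStokesRegularity.NavierStokesRegularity.Theses
open Summit.NavierStokesRegularity.FluidComputer.PalasekTowerClayBridge

/-- **Modulo the route's uniqueness item, `HeredityFromTwo` IS the heredity witness at every level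
`k ≥ 2`**. [cite: Tao2011, Cor. 11.4] -/
theorem palasekTowerBreakdown_heredityFromTwo_iff_heredityWitness
    (hU : PalasekTowerBreakdown.TaoForcedUniqueness) :
    PalasekTowerBreakdown.HeredityFromTwo ↔ ∀ k : ℕ, 2 ≤ k → HeredityWitness k := by
  unfold PalasekTowerBreakdown.HeredityFromTwo
  unfold PalasekTowerBreakdown.TaoForcedUniqueness at hU
  exact heredityFrom_iff_heredityWitness
    (Literature.Analysis.FluidPDE.tao2011_forced_unconditionalUniqueness_velocity.schwartzForce hU)

/-- **Item `HeredityFromTwo` from the route's uniqueness item and the typed heredity witnesses at all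
levels `k ≥ 2`**. [cite: Tao2011, Cor. 11.4] -/
theorem palasekTowerBreakdown_heredityFromTwo_of_heredityWitness
    (hU : PalasekTowerBreakdown.TaoForcedUniqueness) (h : ∀ k : ℕ, 2 ≤ k → HeredityWitness k) :
    PalasekTowerBreakdown.HeredityFromTwo :=
  (palasekTowerBreakdown_heredityFromTwo_iff_heredityWitness hU).2 h

/-- The free direction needs no uniqueness: the item yields every witness at level `k ≥ 2`.
[folklore] -/
theorem palasekTowerBreakdown_heredityWitness_of_heredityFromTwo
    (h : PalasekTowerBreakdown.HeredityFromTwo) {k : ℕ} (hk : 2 ≤ k) : HeredityWitness k := by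
  unfold PalasekTowerBreakdown.HeredityFromTwo at h
  exact (h.heredityAt hk).heredityWitness

end Summit.NavierStokesRegularity.NavierStokesRegularity.Theorems
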